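import Literature.NumberTheory.Sieve.SmoothRestrictionOversampled
import Literature.NumberTheory.Sieve.RamanujanSum
import Mathlib.Analysis.MeanInequalities
import HarnessLib

/-!
# Hölder `(5/2, 5/2, 5)` and restriction for ternary products of friable exponential sums

Topic `Literature/NumberTheory/Sieve`; a PROVED file. The crude upper bound of the circle method
for friable solutions of `d₁n₁ ± d₂n₂ = d₃n₃` with the three variables at three scales
`x₁, x₂, x₃` ([Harper2016, §5], the treatment of the minor arcs via Theorem 2 and Hölder's
inequality, here with three different scales, dilations `d_i` of the phases coprime to the number
`N₀` of sample points, and the supremum of the third factor kept explicit):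

`ternary_holder_restriction`: with `𝓟(x) = x^α ζ(α,y)/√φ₂(α,y)`, `α = α(x,y)`, and
`V_i(θ) = ∑_{n ∈ S(x_i,y)} a_i(n) e(nθ)` (`|a_i| ≤ 1`), for `T ⊆ [0, N₀)`, `(d_i, N₀) = 1` and
`S₃ ≥ sup_{r ∈ T} |V₃(d₃r/N₀)|`,

`∑_{r ∈ T} |V₁(d₁r/N₀)| |V₂(d₂r/N₀)| |V₃(d₃r/N₀)| ≤ C (log x₁ log x₂ log x₃)⁸ (1+N₀/x₁)^{2/5}`
`(1+N₀/x₂)^{2/5} (1+N₀/x₃)^{1/5} 𝓟(x₁) 𝓟(x₂) 𝓟(x₃)^{1/2} S₃^{1/2}`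

in Harper's regime at each scale (the side conditions of the tree's
`discreteRestriction_five_halves_oversampled`, SmoothRestrictionOversampled.lean, which is the input).

Steps (namespace `TernaryHolder`):
* `inner_le_Lp_mul_Lq_mul_Lr_of_nonneg`, `holder_five_halves`: Hölder for three non-negative
  functions on a finite set (from Mathlib's two-factor `Real.inner_le_Lp_mul_Lq_of_nonneg` and
  `Real.Lr_rpow_le_Lp_mul_Lq_of_nonneg`), and its case `(5/2, 5/2, 5)`;
* `fourierChar_dilate_eq`, `dilate_injOn`, `sum_dilate_le`, `sum_dilate_norm_rpow_le`: for
  `(d, N₀) = 1`, `e(n d r/N₀) = e(n k/N₀)` with `k = d r mod N₀` (`e(ℤ) = 1` from RamanujanSum.lean),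
  and `r ↦ d r mod N₀` is injective
  on `[0, N₀)`, so moments over the dilated sub-grid `{d r/N₀ : r ∈ T}` are at most the moments
  over the full grid `{k/N₀ : k < N₀}` (restriction at `θ₀ = 0`);
* `profile_pos`, `bound_rpow_le`, `assemble`: `𝓟 > 0`, `|V₃|⁵ ≤ S₃^{5/2} |V₃|^{5/2}` and the `rpow`
  bookkeeping `(C L^{19} O 𝓟^{5/2})^{2/5} ≤ C^{2/5} L⁸ O^{2/5} 𝓟` (`L = log x ≥ 1` as `x ≥ 3`),
  `C^{2/5+2/5+1/5} = C`.

## References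

* A. J. Harper, *Minor arcs, mean values, and restriction theory for exponential sums over smooth
  numbers*, Compositio Math. 152 (2016) 1121–1158, Theorem 2 and §5 [Harper2016].
-/

noncomputable section

open Finset Real
open scoped FourierTransform

namespace Literature.NumberTheory.Sieve

namespace TernaryHolder

/-! ### Hölder's inequality for three functions -/

/-- **Hölder's inequality for three non-negative functions** (finite sums): for `p, q, r > 0` with
`1/p + 1/q + 1/r = 1`, `∑ f g h ≤ (∑ f^p)^{1/p} (∑ g^q)^{1/q} (∑ h^r)^{1/r}`. From the two-factor
inequality applied to `f · (g h)` with exponents `(p, t)`, `1/t = 1/q + 1/r`, and to `(g h)^t`.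
[folklore] -/
theorem inner_le_Lp_mul_Lq_mul_Lr_of_nonneg {ι : Type*} (s : Finset ι) {f g h : ι → ℝ}
    {p q r : ℝ} (hp : 0 < p) (hq : 0 < q) (hr : 0 < r) (hpqr : p⁻¹ + q⁻¹ + r⁻¹ = 1)
    (hf : ∀ i ∈ s, 0 ≤ f i) (hg : ∀ i ∈ s, 0 ≤ g i) (hh : ∀ i ∈ s, 0 ≤ h i) :
    ∑ i ∈ s, f i * g i * h i ≤
      (∑ i ∈ s, f i ^ p) ^ (1 / p) * (∑ i ∈ s, g i ^ q) ^ (1 / q) * (∑ i ∈ s, h i ^ r) ^ (1 / r) := by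
  have hqr : q.HolderTriple r (q⁻¹ + r⁻¹)⁻¹ := Real.HolderTriple.of_pos hq hr
  set t : ℝ := (q⁻¹ + r⁻¹)⁻¹ with ht
  have ht0 : 0 < t := hqr.pos'
  have hpt : p.HolderConjugate t :=
    ⟨by rw [ht, inv_inv, inv_one, ← add_assoc]; exact hpqr, hp, ht0⟩
  have hgh : ∀ i ∈ s, 0 ≤ g i * h i := fun i hi => mul_nonneg (hg i hi) (hh i hi)
  have h1 := Real.inner_le_Lp_mul_Lq_of_nonneg s hpt hf hgh
  have h2 := Real.Lr_rpow_le_Lp_mul_Lq_of_nonneg s hqr hg hh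
  have hG0 : 0 ≤ ∑ i ∈ s, g i ^ q := Finset.sum_nonneg fun i hi => Real.rpow_nonneg (hg i hi) _
  have hH0 : 0 ≤ ∑ i ∈ s, h i ^ r := Finset.sum_nonneg fun i hi => Real.rpow_nonneg (hh i hi) _
  have hF0 : 0 ≤ ∑ i ∈ s, f i ^ p := Finset.sum_nonneg fun i hi => Real.rpow_nonneg (hf i hi) _
  have hGH0 : 0 ≤ ∑ i ∈ s, (g i * h i) ^ t :=
    Finset.sum_nonneg fun i hi => Real.rpow_nonneg (hgh i hi) _
  have h3 : (∑ i ∈ s, (g i * h i) ^ t) ^ (1 / t) ≤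
      (∑ i ∈ s, g i ^ q) ^ (1 / q) * (∑ i ∈ s, h i ^ r) ^ (1 / r) := by
    calc (∑ i ∈ s, (g i * h i) ^ t) ^ (1 / t)
        ≤ ((∑ i ∈ s, g i ^ q) ^ (t / q) * (∑ i ∈ s, h i ^ r) ^ (t / r)) ^ (1 / t) :=
          Real.rpow_le_rpow hGH0 h2 (by positivity)
      _ = (∑ i ∈ s, g i ^ q) ^ (1 / q) * (∑ i ∈ s, h i ^ r) ^ (1 / r) := by
          rw [Real.mul_rpow (Real.rpow_nonneg hG0 _) (Real.rpow_nonneg hH0 _),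
            ← Real.rpow_mul hG0, ← Real.rpow_mul hH0]
          have e1 : t / q * (1 / t) = 1 / q := by field_simp
          have e2 : t / r * (1 / t) = 1 / r := by field_simp
          rw [e1, e2]
  calc ∑ i ∈ s, f i * g i * h i = ∑ i ∈ s, f i * (g i * h i) := by simp_rw [mul_assoc]
    _ ≤ (∑ i ∈ s, f i ^ p) ^ (1 / p) * (∑ i ∈ s, (g i * h i) ^ t) ^ (1 / t) := h1
    _ ≤ (∑ i ∈ s, f i ^ p) ^ (1 / p) *
          ((∑ i ∈ s, g i ^ q) ^ (1 / q) * (∑ i ∈ s, h i ^ r) ^ (1 / r)) :=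
        mul_le_mul_of_nonneg_left h3 (Real.rpow_nonneg hF0 _)
    _ = _ := by ring

/-- **Hölder with exponents `(5/2, 5/2, 5)`**: for non-negative `f, g, h`,
`∑ f g h ≤ (∑ f^{5/2})^{2/5} (∑ g^{5/2})^{2/5} (∑ h^5)^{1/5}`. [folklore] -/
theorem holder_five_halves {ι : Type*} (s : Finset ι) {f g h : ι → ℝ}
    (hf : ∀ i ∈ s, 0 ≤ f i) (hg : ∀ i ∈ s, 0 ≤ g i) (hh : ∀ i ∈ s, 0 ≤ h i) :
    ∑ i ∈ s, f i * g i * h i ≤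
      (∑ i ∈ s, f i ^ ((5 : ℝ) / 2)) ^ ((2 : ℝ) / 5) * (∑ i ∈ s, g i ^ ((5 : ℝ) / 2)) ^ ((2 : ℝ) / 5) *
        (∑ i ∈ s, h i ^ (5 : ℕ)) ^ ((1 : ℝ) / 5) := by
  have h := inner_le_Lp_mul_Lq_mul_Lr_of_nonneg s (p := 5 / 2) (q := 5 / 2) (r := 5)
    (by norm_num) (by norm_num) (by norm_num) (by norm_num) hf hg hh
  norm_num at h
  exact h

/-! ### Dilation by a unit modulo `N₀` -/

/-- **Reduction of the dilated phase modulo one**: for an integer `n`,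
`e(n · d r/N₀) = e(n · k/N₀)` with `k = (d r) mod N₀ ∈ [0, N₀)` (`e(m) = 1` for `m ∈ ℤ`,
`RamanujanSum.fourierChar_intCast`). [folklore] -/
theorem fourierChar_dilate_eq {N₀ : ℕ} (hN₀ : 1 ≤ N₀) (d : ℤ) (r n : ℕ) :
    (𝐞 ((n : ℝ) * ((d * r : ℝ) / N₀)) : ℂ) =
      (𝐞 ((n : ℝ) * ((((d * r) % (N₀ : ℤ)).toNat : ℝ) / N₀)) : ℂ) := by
  have hN : (0 : ℤ) < N₀ := by exact_mod_cast hN₀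
  have hNr : (N₀ : ℝ) ≠ 0 := by exact_mod_cast hN.ne'
  set k : ℤ := (d * r) % (N₀ : ℤ) with hk
  set q : ℤ := (d * r) / (N₀ : ℤ) with hq
  have hk0 : 0 ≤ k := Int.emod_nonneg _ hN.ne'
  have hkq : (N₀ : ℤ) * q + k = d * r := Int.mul_ediv_add_emod _ _
  have hcast : ((k.toNat : ℕ) : ℝ) = (k : ℝ) := by
    rw [← Int.cast_natCast, Int.toNat_of_nonneg hk0]
  have hreal : (d : ℝ) * r = N₀ * q + k := by exact_mod_cast hkq.symm
  have hphase : (n : ℝ) * ((d * r : ℝ) / N₀) = (n : ℝ) * ((k.toNat : ℝ) / N₀) + ((n * q : ℤ) : ℝ) := by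
    rw [hcast, hreal]; push_cast; field_simp; ring
  rw [hphase, AddChar.map_add_eq_mul, Circle.coe_mul, RamanujanSum.fourierChar_intCast, mul_one]

/-- **Dilation by a unit is injective modulo `N₀`**: for `(d, N₀) = 1` the map
`r ↦ (d r) mod N₀` is injective on `[0, N₀)`. [folklore] -/
theorem dilate_injOn {N₀ : ℕ} (hN₀ : 1 ≤ N₀) {d : ℤ} (hd : IsCoprime d N₀) :
    Set.InjOn (fun r : ℕ => ((d * r) % (N₀ : ℤ)).toNat) (Finset.range N₀ : Set ℕ) := by
  intro r hr r' hr' h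
  have hN : (0 : ℤ) < N₀ := by exact_mod_cast hN₀
  rw [Finset.coe_range, Set.mem_Iio] at hr hr'
  have h0 : 0 ≤ (d * r) % (N₀ : ℤ) := Int.emod_nonneg _ hN.ne'
  have h0' : 0 ≤ (d * r') % (N₀ : ℤ) := Int.emod_nonneg _ hN.ne'
  have hmod : (d * r) % (N₀ : ℤ) = (d * r') % (N₀ : ℤ) := by
    have := congrArg (fun m : ℕ => (m : ℤ)) h
    simpa only [Int.toNat_of_nonneg h0, Int.toNat_of_nonneg h0'] using this
  have hdvd : (N₀ : ℤ) ∣ d * ((r' : ℤ) - r) := by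
    rw [mul_sub]; exact Int.ModEq.dvd hmod
  have hdvd' : (N₀ : ℤ) ∣ (r' : ℤ) - r := hd.symm.dvd_of_dvd_mul_left hdvd
  have habs : |(r' : ℤ) - r| < N₀ := abs_lt.mpr ⟨by omega, by omega⟩
  have := Int.eq_zero_of_abs_lt_dvd hdvd' habs
  omega

/-- **Sums over a dilated sub-grid**: for `(d, N₀) = 1`, `T ⊆ [0, N₀)` and `G ≥ 0`,
`∑_{r ∈ T} G((d r) mod N₀) ≤ ∑_{k < N₀} G(k)`. [folklore] -/
theorem sum_dilate_le {N₀ : ℕ} (hN₀ : 1 ≤ N₀) {d : ℤ} (hd : IsCoprime d N₀) {T : Finset ℕ}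
    (hT : T ⊆ Finset.range N₀) (G : ℕ → ℝ) (hG : ∀ k, 0 ≤ G k) :
    ∑ r ∈ T, G (((d * r) % (N₀ : ℤ)).toNat) ≤ ∑ k ∈ Finset.range N₀, G k := by
  have hN : (0 : ℤ) < N₀ := by exact_mod_cast hN₀
  rw [← Finset.sum_image (g := fun r : ℕ => ((d * r) % (N₀ : ℤ)).toNat)
    ((dilate_injOn hN₀ hd).mono (Finset.coe_subset.mpr hT))]
  refine Finset.sum_le_sum_of_subset_of_nonneg (fun k hk => ?_) fun k _ _ => hG k
  obtain ⟨r, -, rfl⟩ := Finset.mem_image.mp hk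
  have h1 := Int.emod_lt_of_pos (d * r) hN
  have h2 := Int.emod_nonneg (d * r) hN.ne'
  rw [Finset.mem_range]
  omega

/-! ### rpow bookkeeping -/

/-- `(C L^{19} O P^{5/2})^e ≤ C^e L^8 O^e P^{5e/2}` for `L ≥ 1`, `19 e ≤ 8`. [folklore] -/
theorem bound_rpow_le {C L O P e : ℝ} (hC : 0 ≤ C) (hL : 1 ≤ L) (hO : 0 ≤ O) (hP : 0 ≤ P)
    (he8 : 19 * e ≤ 8) :
    (C * L ^ (19 : ℕ) * O * P ^ ((5 : ℝ) / 2)) ^ e ≤ C ^ e * L ^ (8 : ℕ) * O ^ e * P ^ (5 / 2 * e) := by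
  have hL0 : 0 ≤ L := by linarith
  rw [Real.mul_rpow (by positivity) (by positivity), Real.mul_rpow (by positivity) hO,
    Real.mul_rpow hC (by positivity), ← Real.rpow_mul hP]
  have key : (L ^ (19 : ℕ)) ^ e ≤ L ^ (8 : ℕ) := by
    rw [← Real.rpow_natCast L 19, ← Real.rpow_mul hL0, ← Real.rpow_natCast L 8]
    exact Real.rpow_le_rpow_of_exponent_le hL (by push_cast; linarith)
  gcongr


/-- **Positivity of the profile** `𝓟 = x^α ζ(α,y)/√φ₂(α,y)` when `x > 1` and `α(x,y) ≥ 1 − 10⁻⁴`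
(which forces `y ≥ 2`). [folklore] -/
theorem profile_pos {x : ℝ} {y : ℕ} (hx : 1 < x) (hα : 1 - 1 / 10000 ≤ saddlePoint x y) :
    0 < x ^ saddlePoint x y *
      (smoothZeta (saddlePoint x y) y / Real.sqrt (saddlePhi₂ (saddlePoint x y) y)) := by
  have hy2 : 2 ≤ y := by
    by_contra hlt
    push Not at hlt
    have h0 : saddlePoint x y = 0 := by
      rw [saddlePoint, dif_neg (fun h => absurd h.2 (by omega))]
    rw [h0] at hα; norm_num at hα
  have hx0 : 0 < x := by linarith
  have hα0 : 0 < saddlePoint x y := saddlePoint_pos hx hy2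
  have hζ : 0 < smoothZeta (saddlePoint x y) y := smoothZeta_pos hα0
  have hφ : 0 < saddlePhi₂ (saddlePoint x y) y := saddlePhi₂_pos hy2 hα0
  positivity

/-- **Restriction on a dilated sub-grid.** A bound for `∑_{k<N₀} |V(k/N₀)|^p` gives the same bound
for `∑_{r ∈ T} |V(d r/N₀)|^p` when `(d, N₀) = 1` and `T ⊆ [0, N₀)`: the phases only depend on
`(d r) mod N₀`, and `r ↦ (d r) mod N₀` is injective. [folklore] -/
theorem sum_dilate_norm_rpow_le {N₀ : ℕ} (hN₀ : 1 ≤ N₀) {d : ℤ} (hd : IsCoprime d N₀)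
    {T : Finset ℕ} (hT : T ⊆ Finset.range N₀) (S : Finset ℕ) (a : ℕ → ℂ) (p : ℝ) {B : ℝ}
    (hB : ∑ k ∈ Finset.range N₀,
        ‖∑ n ∈ S, a n * (𝐞 ((n : ℝ) * (0 + (k : ℝ) / N₀)) : ℂ)‖ ^ p ≤ B) :
    ∑ r ∈ T, ‖∑ n ∈ S, a n * (𝐞 ((n : ℝ) * ((d * r : ℝ) / N₀)) : ℂ)‖ ^ p ≤ B := by
  have h := sum_dilate_le hN₀ hd hT
    (fun k => ‖∑ n ∈ S, a n * (𝐞 ((n : ℝ) * ((k : ℝ) / N₀)) : ℂ)‖ ^ p) (fun k => by positivity)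
  simp only [zero_add] at hB
  refine le_trans (le_of_eq (Finset.sum_congr rfl fun r _ => ?_)) (h.trans hB)
  simp_rw [fourierChar_dilate_eq hN₀ d r]

/-- **Assembly of the Hölder–restriction bound** (pure real bookkeeping): if `f, g, h ≥ 0` on `T`
have `L^{5/2}(T)` moments `≤ C L_i^{19} O_i P_i^{5/2}` (`L_i ≥ 1`) and `h ≤ S₃` on `T`, then
`∑_T f g h ≤ C (L₁L₂L₃)^8 O₁^{2/5} O₂^{2/5} O₃^{1/5} P₁ P₂ P₃^{1/2} S₃^{1/2}`. [folklore] -/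
theorem assemble {T : Finset ℕ} {f g h : ℕ → ℝ} (hf0 : ∀ r, 0 ≤ f r) (hg0 : ∀ r, 0 ≤ g r)
    (hh0 : ∀ r, 0 ≤ h r) {C L₁ L₂ L₃ O₁ O₂ O₃ P₁ P₂ P₃ S₃ : ℝ} (hC : 0 < C)
    (hL₁ : 1 ≤ L₁) (hL₂ : 1 ≤ L₂) (hL₃ : 1 ≤ L₃) (hO₁ : 0 ≤ O₁) (hO₂ : 0 ≤ O₂) (hO₃ : 0 ≤ O₃)
    (hP₁ : 0 ≤ P₁) (hP₂ : 0 ≤ P₂) (hP₃ : 0 ≤ P₃) (hS₃ : 0 ≤ S₃)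
    (hf : ∑ r ∈ T, f r ^ ((5 : ℝ) / 2) ≤ C * L₁ ^ (19 : ℕ) * O₁ * P₁ ^ ((5 : ℝ) / 2))
    (hg : ∑ r ∈ T, g r ^ ((5 : ℝ) / 2) ≤ C * L₂ ^ (19 : ℕ) * O₂ * P₂ ^ ((5 : ℝ) / 2))
    (hh : ∑ r ∈ T, h r ^ ((5 : ℝ) / 2) ≤ C * L₃ ^ (19 : ℕ) * O₃ * P₃ ^ ((5 : ℝ) / 2))
    (hsup : ∀ r ∈ T, h r ≤ S₃) :
    ∑ r ∈ T, f r * g r * h r ≤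
      C * (L₁ * L₂ * L₃) ^ (8 : ℕ) * O₁ ^ (2 / 5 : ℝ) * O₂ ^ (2 / 5 : ℝ) * O₃ ^ (1 / 5 : ℝ) *
        P₁ * P₂ * P₃ ^ (1 / 2 : ℝ) * S₃ ^ (1 / 2 : ℝ) := by
  -- `∑ h^5 ≤ S₃^{5/2} ∑ h^{5/2}`
  have hh5 : ∑ r ∈ T, h r ^ (5 : ℕ) ≤ S₃ ^ ((5 : ℝ) / 2) * (C * L₃ ^ (19 : ℕ) * O₃ * P₃ ^ ((5 : ℝ) / 2)) := by
    calc ∑ r ∈ T, h r ^ (5 : ℕ) ≤ ∑ r ∈ T, S₃ ^ ((5 : ℝ) / 2) * h r ^ ((5 : ℝ) / 2) := by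
          refine Finset.sum_le_sum fun r hr => ?_
          calc h r ^ (5 : ℕ) = h r ^ ((5 : ℝ) / 2) * h r ^ ((5 : ℝ) / 2) := by
                rw [← Real.rpow_add' (hh0 r) (by norm_num)]; norm_num
            _ ≤ S₃ ^ ((5 : ℝ) / 2) * h r ^ ((5 : ℝ) / 2) :=
                mul_le_mul_of_nonneg_right (Real.rpow_le_rpow (hh0 r) (hsup r hr) (by norm_num))
                  (Real.rpow_nonneg (hh0 r) _)
      _ = S₃ ^ ((5 : ℝ) / 2) * ∑ r ∈ T, h r ^ ((5 : ℝ) / 2) := by rw [Finset.mul_sum]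
      _ ≤ _ := mul_le_mul_of_nonneg_left hh (by positivity)
  -- Hölder
  have hH := holder_five_halves T (f := f) (g := g) (h := h) (fun r _ => hf0 r) (fun r _ => hg0 r)
    (fun r _ => hh0 r)
  -- the three factors
  have hF0 : 0 ≤ ∑ r ∈ T, f r ^ ((5 : ℝ) / 2) := Finset.sum_nonneg fun r _ => Real.rpow_nonneg (hf0 r) _
  have hG0 : 0 ≤ ∑ r ∈ T, g r ^ ((5 : ℝ) / 2) := Finset.sum_nonneg fun r _ => Real.rpow_nonneg (hg0 r) _
  have hH0 : 0 ≤ ∑ r ∈ T, h r ^ (5 : ℕ) := Finset.sum_nonneg fun r _ => pow_nonneg (hh0 r) _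
  have hF : (∑ r ∈ T, f r ^ ((5 : ℝ) / 2)) ^ ((2 : ℝ) / 5) ≤ C ^ ((2 : ℝ) / 5) * L₁ ^ (8 : ℕ) * O₁ ^ ((2 : ℝ) / 5) * P₁ := by
    calc _ ≤ (C * L₁ ^ (19 : ℕ) * O₁ * P₁ ^ ((5 : ℝ) / 2)) ^ ((2 : ℝ) / 5) :=
          Real.rpow_le_rpow hF0 hf (by norm_num)
      _ ≤ C ^ ((2 : ℝ) / 5) * L₁ ^ (8 : ℕ) * O₁ ^ ((2 : ℝ) / 5) * P₁ ^ (5 / 2 * ((2 : ℝ) / 5)) :=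
          bound_rpow_le hC.le hL₁ hO₁ hP₁ (by norm_num)
      _ = _ := by rw [show (5 : ℝ) / 2 * ((2 : ℝ) / 5) = 1 by norm_num, Real.rpow_one]
  have hG : (∑ r ∈ T, g r ^ ((5 : ℝ) / 2)) ^ ((2 : ℝ) / 5) ≤ C ^ ((2 : ℝ) / 5) * L₂ ^ (8 : ℕ) * O₂ ^ ((2 : ℝ) / 5) * P₂ := by
    calc _ ≤ (C * L₂ ^ (19 : ℕ) * O₂ * P₂ ^ ((5 : ℝ) / 2)) ^ ((2 : ℝ) / 5) :=
          Real.rpow_le_rpow hG0 hg (by norm_num)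
      _ ≤ C ^ ((2 : ℝ) / 5) * L₂ ^ (8 : ℕ) * O₂ ^ ((2 : ℝ) / 5) * P₂ ^ (5 / 2 * ((2 : ℝ) / 5)) :=
          bound_rpow_le hC.le hL₂ hO₂ hP₂ (by norm_num)
      _ = _ := by rw [show (5 : ℝ) / 2 * ((2 : ℝ) / 5) = 1 by norm_num, Real.rpow_one]
  have hHf : (∑ r ∈ T, h r ^ (5 : ℕ)) ^ ((1 : ℝ) / 5) ≤
      S₃ ^ (1 / 2 : ℝ) * (C ^ ((1 : ℝ) / 5) * L₃ ^ (8 : ℕ) * O₃ ^ ((1 : ℝ) / 5) * P₃ ^ (1 / 2 : ℝ)) := by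
    calc _ ≤ (S₃ ^ ((5 : ℝ) / 2) * (C * L₃ ^ (19 : ℕ) * O₃ * P₃ ^ ((5 : ℝ) / 2))) ^ ((1 : ℝ) / 5) :=
          Real.rpow_le_rpow hH0 hh5 (by norm_num)
      _ = S₃ ^ (1 / 2 : ℝ) * (C * L₃ ^ (19 : ℕ) * O₃ * P₃ ^ ((5 : ℝ) / 2)) ^ ((1 : ℝ) / 5) := by
          rw [Real.mul_rpow (by positivity) (by positivity), ← Real.rpow_mul hS₃,
            show (5 : ℝ) / 2 * ((1 : ℝ) / 5) = 1 / 2 by norm_num]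
      _ ≤ S₃ ^ (1 / 2 : ℝ) *
            (C ^ ((1 : ℝ) / 5) * L₃ ^ (8 : ℕ) * O₃ ^ ((1 : ℝ) / 5) * P₃ ^ (5 / 2 * ((1 : ℝ) / 5))) :=
          mul_le_mul_of_nonneg_left (bound_rpow_le hC.le hL₃ hO₃ hP₃ (by norm_num)) (by positivity)
      _ = _ := by rw [show (5 : ℝ) / 2 * ((1 : ℝ) / 5) = 1 / 2 by norm_num]
  have hX0 : 0 ≤ (∑ r ∈ T, g r ^ ((5 : ℝ) / 2)) ^ ((2 : ℝ) / 5) := Real.rpow_nonneg hG0 _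
  have hZ0 : 0 ≤ (∑ r ∈ T, h r ^ (5 : ℕ)) ^ ((1 : ℝ) / 5) := Real.rpow_nonneg hH0 _
  have hCe : C ^ ((2 : ℝ) / 5) * C ^ ((2 : ℝ) / 5) * C ^ ((1 : ℝ) / 5) = C := by
    rw [← Real.rpow_add hC, ← Real.rpow_add hC]; norm_num
  calc ∑ r ∈ T, f r * g r * h r ≤ _ := hH
    _ ≤ (C ^ ((2 : ℝ) / 5) * L₁ ^ (8 : ℕ) * O₁ ^ ((2 : ℝ) / 5) * P₁) *
          (C ^ ((2 : ℝ) / 5) * L₂ ^ (8 : ℕ) * O₂ ^ ((2 : ℝ) / 5) * P₂) *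
          (S₃ ^ (1 / 2 : ℝ) * (C ^ ((1 : ℝ) / 5) * L₃ ^ (8 : ℕ) * O₃ ^ ((1 : ℝ) / 5) * P₃ ^ (1 / 2 : ℝ))) :=
        mul_le_mul (mul_le_mul hF hG hX0 (by positivity)) hHf hZ0 (by positivity)
    _ = C ^ ((2 : ℝ) / 5) * C ^ ((2 : ℝ) / 5) * C ^ ((1 : ℝ) / 5) *
          ((L₁ * L₂ * L₃) ^ (8 : ℕ) * O₁ ^ (2 / 5 : ℝ) * O₂ ^ (2 / 5 : ℝ) * O₃ ^ (1 / 5 : ℝ) *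
            P₁ * P₂ * P₃ ^ (1 / 2 : ℝ) * S₃ ^ (1 / 2 : ℝ)) := by ring
    _ = _ := by rw [hCe]; ring

end TernaryHolder

open TernaryHolder in
/-- **Hölder `(5/2, 5/2, 5)` and oversampled restriction for a ternary product of friable
exponential sums at three scales.** With `𝓟(x) = x^{α} ζ(α,y)/√φ₂(α,y)` (`α = α(x,y)`) and
`V_i(θ) = ∑_{n ∈ S(x_i,y)} a_i(n) e(nθ)`, `|a_i(n)| ≤ 1`, in Harper's regime at each of the three scales
`x₁, x₂, x₃` (`x_i ≥ x₀`, `(log x_i)^8 ≤ y`, `log y ≤ ½ (log x_i)^{1/6}`, `y^{200} ≤ x_i`,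
`α(x_i,y) ≥ 1 − 10⁻⁴`, `Ψ(x_i,y) ≥ x_i^{39999/40000}`): for every `N₀ ≥ 1`, dilations `d_i` coprime to
`N₀`, every `T ⊆ [0, N₀)` and every `S₃ ≥ sup_{r ∈ T} |V₃(d₃ r/N₀)|`,
`∑_{r ∈ T} |V₁(d₁r/N₀)| |V₂(d₂r/N₀)| |V₃(d₃r/N₀)| ≤ C (log x₁ log x₂ log x₃)^8 (1+N₀/x₁)^{2/5}
(1+N₀/x₂)^{2/5} (1+N₀/x₃)^{1/5} 𝓟(x₁) 𝓟(x₂) 𝓟(x₃)^{1/2} S₃^{1/2}`. Proof: `r ↦ d_i r mod N₀` permutes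
the grid, so `∑_{r ∈ T} |V_i(d_i r/N₀)|^{5/2} ≤ C (log x_i)^{19} (1+N₀/x_i) 𝓟(x_i)^{5/2}`
(`discreteRestriction_five_halves_oversampled` at `θ₀ = 0`); Hölder with exponents `(5/2, 5/2, 5)` and
`|V₃|^5 ≤ S₃^{5/2} |V₃|^{5/2}`. [cite: Harper2016, Theorem 2 and §5] -/
theorem ternary_holder_restriction :
    ∃ C x₀ : ℝ, 0 < C ∧ ∀ (y : ℕ) (x₁ x₂ x₃ : ℝ),
      x₀ ≤ x₁ → Real.log x₁ ^ 8 ≤ (y : ℝ) → Real.log (y : ℝ) ≤ 1 / 2 * Real.log x₁ ^ (1 / 6 : ℝ) →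
      (y : ℝ) ^ 200 ≤ x₁ → 1 - 1 / 10000 ≤ saddlePoint x₁ y →
      x₁ ^ ((39999 : ℝ) / 40000) ≤ ((Nat.smoothNumbersUpTo ⌊x₁⌋₊ (y + 1)).card : ℝ) →
      x₀ ≤ x₂ → Real.log x₂ ^ 8 ≤ (y : ℝ) → Real.log (y : ℝ) ≤ 1 / 2 * Real.log x₂ ^ (1 / 6 : ℝ) →
      (y : ℝ) ^ 200 ≤ x₂ → 1 - 1 / 10000 ≤ saddlePoint x₂ y →
      x₂ ^ ((39999 : ℝ) / 40000) ≤ ((Nat.smoothNumbersUpTo ⌊x₂⌋₊ (y + 1)).card : ℝ) →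
      x₀ ≤ x₃ → Real.log x₃ ^ 8 ≤ (y : ℝ) → Real.log (y : ℝ) ≤ 1 / 2 * Real.log x₃ ^ (1 / 6 : ℝ) →
      (y : ℝ) ^ 200 ≤ x₃ → 1 - 1 / 10000 ≤ saddlePoint x₃ y →
      x₃ ^ ((39999 : ℝ) / 40000) ≤ ((Nat.smoothNumbersUpTo ⌊x₃⌋₊ (y + 1)).card : ℝ) →
      ∀ (N₀ : ℕ), 1 ≤ N₀ → ∀ (d₁ d₂ d₃ : ℤ), IsCoprime d₁ (N₀ : ℤ) → IsCoprime d₂ (N₀ : ℤ) →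
      IsCoprime d₃ (N₀ : ℤ) →
      ∀ (a₁ a₂ a₃ : ℕ → ℂ), (∀ n, ‖a₁ n‖ ≤ 1) → (∀ n, ‖a₂ n‖ ≤ 1) → (∀ n, ‖a₃ n‖ ≤ 1) →
      ∀ (T : Finset ℕ), T ⊆ Finset.range N₀ → ∀ (S₃ : ℝ), 0 ≤ S₃ →
      (∀ r ∈ T, ‖∑ n ∈ Nat.smoothNumbersUpTo ⌊x₃⌋₊ (y + 1),
          a₃ n * (𝐞 ((n : ℝ) * ((d₃ * r : ℝ) / N₀)) : ℂ)‖ ≤ S₃) →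
        ∑ r ∈ T,
          ‖∑ n ∈ Nat.smoothNumbersUpTo ⌊x₁⌋₊ (y + 1), a₁ n * (𝐞 ((n : ℝ) * ((d₁ * r : ℝ) / N₀)) : ℂ)‖ *
          ‖∑ n ∈ Nat.smoothNumbersUpTo ⌊x₂⌋₊ (y + 1), a₂ n * (𝐞 ((n : ℝ) * ((d₂ * r : ℝ) / N₀)) : ℂ)‖ *
          ‖∑ n ∈ Nat.smoothNumbersUpTo ⌊x₃⌋₊ (y + 1), a₃ n * (𝐞 ((n : ℝ) * ((d₃ * r : ℝ) / N₀)) : ℂ)‖ ≤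
        C * (Real.log x₁ * Real.log x₂ * Real.log x₃) ^ (8 : ℕ) *
          (1 + (N₀ : ℝ) / x₁) ^ (2 / 5 : ℝ) * (1 + (N₀ : ℝ) / x₂) ^ (2 / 5 : ℝ) *
          (1 + (N₀ : ℝ) / x₃) ^ (1 / 5 : ℝ) *
          (x₁ ^ saddlePoint x₁ y *
            (smoothZeta (saddlePoint x₁ y) y / Real.sqrt (saddlePhi₂ (saddlePoint x₁ y) y))) *
          (x₂ ^ saddlePoint x₂ y *
            (smoothZeta (saddlePoint x₂ y) y / Real.sqrt (saddlePhi₂ (saddlePoint x₂ y) y))) *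
          (x₃ ^ saddlePoint x₃ y *
            (smoothZeta (saddlePoint x₃ y) y / Real.sqrt (saddlePhi₂ (saddlePoint x₃ y) y))) ^
              (1 / 2 : ℝ) *
          S₃ ^ (1 / 2 : ℝ) := by
  obtain ⟨C, x₀, hC, hR⟩ := discreteRestriction_five_halves_oversampled
  refine ⟨C, max x₀ 3, hC, ?_⟩
  intro y x₁ x₂ x₃ hx₁ hy8₁ hy6₁ hy200₁ hα₁ hΨ₁ hx₂ hy8₂ hy6₂ hy200₂ hα₂ hΨ₂ hx₃ hy8₃ hy6₃ hy200₃ hα₃ hΨ₃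
    N₀ hN₀ d₁ d₂ d₃ hd₁ hd₂ hd₃ a₁ a₂ a₃ ha₁ ha₂ ha₃ T hT S₃ hS₃ hsup
  rw [max_le_iff] at hx₁ hx₂ hx₃
  have hx₁0 : 0 < x₁ := by linarith [hx₁.2]
  have hx₂0 : 0 < x₂ := by linarith [hx₂.2]
  have hx₃0 : 0 < x₃ := by linarith [hx₃.2]
  -- `log x ≥ 1` for `x ≥ 3 > e`
  have hlog : ∀ {x : ℝ}, 3 ≤ x → 1 ≤ Real.log x := fun hx => by
    rw [Real.le_log_iff_exp_le (by linarith)]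
    have := Real.exp_one_lt_d9
    linarith
  exact assemble (fun r => norm_nonneg _) (fun r => norm_nonneg _) (fun r => norm_nonneg _) hC
    (hlog hx₁.2) (hlog hx₂.2) (hlog hx₃.2)
    (by positivity) (by positivity) (by positivity)
    (profile_pos (by linarith [hx₁.2]) hα₁).le (profile_pos (by linarith [hx₂.2]) hα₂).le
    (profile_pos (by linarith [hx₃.2]) hα₃).le hS₃
    (sum_dilate_norm_rpow_le hN₀ hd₁ hT _ a₁ _
      (hR x₁ y hx₁.1 hy8₁ hy6₁ hy200₁ hα₁ hΨ₁ N₀ hN₀ 0 a₁ ha₁))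
    (sum_dilate_norm_rpow_le hN₀ hd₂ hT _ a₂ _
      (hR x₂ y hx₂.1 hy8₂ hy6₂ hy200₂ hα₂ hΨ₂ N₀ hN₀ 0 a₂ ha₂))
    (sum_dilate_norm_rpow_le hN₀ hd₃ hT _ a₃ _
      (hR x₃ y hx₃.1 hy8₃ hy6₃ hy200₃ hα₃ hΨ₃ N₀ hN₀ 0 a₃ ha₃))
    hsup


end Literature.NumberTheory.Sieve

end
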